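import Summits.ResolutionOfSingularities.ResolutionOfSingularities.Theorems.PurelyInseparableDim4ResConeCInfLegality
import Summits.ResolutionOfSingularities.ResolutionOfSingularities.Theorems.PurelyInseparableDim4ResConeCInfGameStep
import HarnessLib
import HarnessLib.Audit.Tags

/-!
# Purely inseparable four-folds — TWO-SLOT POWER-CONE GAME, FLAG READING FOR EVERY STATE σ = (n, n) + w, EVERY PRIME:
# isolation along a slot axis lights a present game monomial `(c, a, b, e)` with `b + e + 1 ≤ c` (resp. `a + e + 1 ≤ c`)
# (cell `res-dim4-pi`, K2(p) lane, B rows = power cones, row B-LF (iii-b) «K24a-PRIME readings», β-layer FILE 2; seat res-dim4-p-7 g6)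

[OURS · counted 0 · cell `res-dim4-pi` · K2(p) lane (holder res-dim4-p-12 g5 rulings g5-17, bus 2026-08-29 12:20Z: β-readings = res-dim4-p-7
g6).  AUTHORSHIP of the method: res-dim4-p-1 g3's K24a-β6 `flag_readings_of_corner` (p689613) and res-dim4-p-3 g5's `cInf_flag_reading_prime`
(`…CInfLegalityPrime`, light pair); this file is the σ-PARAMETRIC re-edition in res-dim4-p-1 g6's dictionary
`E(c,a,b,e) = (a+n+1)·j + (b+n+1)·i + (e+w)·u + (d−1−c)·f` (`…TwoSlotGameStepSigma`), read as a STATE property: the isolation axis test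
(res-dim4-p-5's `ordAlong_erase_lt_of_isIsolated`) plus the slot ledger «`f`-degree `≤ d − 1` ⇒ both slot exponents `≥ n + 1`» (transported by
p-1's `ledger_step_zero_sigma`) — no step is involved.  Falsifier: res-dim4-eng-w5 g4's table v0 (F) (KIT j330440; axis lists met n/n).
Seat res-dim4-p-7 g6.]  Nothing here proves any TAIL(p, d, 3), K2(p), `NoIsolatedTrap p p` or resolution of singularities in dimension ≥ 4 /
characteristic `p` — NOT proved.  AI kernel work, weaker than expert review.

* §1 **`flag_reading_axis (p) (hiso) (hdiv) (l)`** — ANY boundary, ANY letter `l`: an isolated `p`-fold point with `x^r ∣ F` carries a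
  monomial `x^{r + m̃}` with `|m̃| + |r| < m̃_l + r_l + p` (the `l`-axis is not `p`-fold).
* §2 **`twoSlot_flagL_gameExp_sigma (p) (hσ : n + w + d = p) (hr : r = n·j + n·i + w·u) (hiso) (hdiv) (hled)`** — along the axis of the
  slot `j`: `∃ c a b e, c + 1 ≤ d ∧ coeff E(c,a,b,e) F ≠ 0 ∧ b + e + 1 ≤ c` (`CInfGame.Exact.no_infinite_play`'s `hflagL`);
  **`twoSlot_flagM_gameExp_sigma`** — along the axis of the slot `i`: `… ∧ a + e + 1 ≤ c` (`hflagM`).  Every prime, every σ.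
[cite: HauserPerlega2019PRIMS, §2 (permissible blowups)] [cite: CossartJannsenSaito2020, Thm. 3.14]
bears_on: LADDER-RESOLUTION:D157-DOOR2 (res-dim4-pi · K2(p) · power cones · two-slot flag reading every prime, every σ).  Supports
stmt-ResolutionOfSingularities-16155 (helper).
-/

set_option linter.dupNamespace false -- mandated namespace of this single-conjunct summit

noncomputable section

namespace Summit.ResolutionOfSingularities.ResolutionOfSingularities.Theorems.PIDim4

namespace ResCone

open MvPolynomial Finset
open Literature.AlgebraicGeometry.Resolution
open Literature.AlgebraicGeometry.Resolution.CentreBlowup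
open Literature.AlgebraicGeometry.Resolution.Hauser2010
open Literature.AlgebraicGeometry.Resolution.HauserPerlega2019

variable {K : Type} [Field K]

/-! ## 1. The axis flag of an isolated point, any boundary -/

/-- **AXIS FLAG, any boundary, any letter**: an ISOLATED `p`-fold point with `x^r ∣ F` carries a monomial `x^{r + m̃}` whose degree off
the letter `l` is `< p`, i.e. `|m̃| + |r| < m̃_l + r_l + p` — isolation forbids the `l`-axis to be `p`-fold
(`ordAlong_erase_lt_of_isIsolated`). [OURS] [cite: HauserPerlega2019PRIMS, §2 (permissible blowups)] -/
theorem flag_reading_axis (p : ℕ) {s : State K} (hiso : IsIsolated p s.F) (hdiv : ∀ e ∈ s.F.support, s.r ≤ e) (l : Fin 4) :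
    ∃ m : Fin 4 →₀ ℕ, coeff (s.r + m) s.F ≠ 0 ∧ m.degree + s.r.degree < m l + s.r l + p := by
  obtain ⟨E, hE, hdegE⟩ := exists_degIn_lt_of_ordAlong_lt (ordAlong_erase_lt_of_isIsolated hiso l)
  obtain ⟨m, rfl⟩ : ∃ m, E = s.r + m := ⟨E - s.r, (add_tsub_cancel_of_le (hdiv E hE)).symm⟩
  refine ⟨m, MvPolynomial.mem_support_iff.mp hE, ?_⟩
  have h := degIn_erase_add_apply l (s.r + m)
  rw [Finsupp.add_apply, map_add] at h
  omega

/-! ## 2. The slot-axis flags in game coordinates `E(c,a,b,e)`, every prime, every σ -/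

section Game

variable {j i u f : Fin 4} (hji : j ≠ i) (hju : j ≠ u) (hjf : j ≠ f) (hiu : i ≠ u) (hif : i ≠ f) (huf : u ≠ f)
include hji hju hjf hiu hif huf

/-- **FLAG ALONG THE AXIS OF THE SLOT `j` IN GAME COORDINATES, every prime, every σ** (`hflagL`): boundary `r = n·j + n·i + w·u`,
`n + w + d = p`; an ISOLATED state with `x^r ∣ F` and the slot ledger («`f`-degree `≤ d − 1` ⇒ both slot exponents `≥ n + 1`») carries a
present game monomial `E(c,a,b,e)`, `c + 1 ≤ d`, with `b + e + 1 ≤ c`.  (The witness of §1 has `|m̃| < m̃_j + d`, so `f`-degree `≤ d − 1`;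
the ledger makes it a game monomial; `|m̃| < m̃_j + d` reads `b + e + 1 ≤ c`.) [OURS] [cite: CossartJannsenSaito2020, Thm. 3.14] -/
theorem twoSlot_flagL_gameExp_sigma (p : ℕ) {n w d : ℕ} (hσ : n + w + d = p) {s : State K}
    (hr : s.r = Finsupp.single j n + Finsupp.single i n + Finsupp.single u w) (hiso : IsIsolated p s.F)
    (hdiv : ∀ e ∈ s.F.support, s.r ≤ e) (hled : ∀ e ∈ s.F.support, e f ≤ d - 1 → n + 1 ≤ e j ∧ n + 1 ≤ e i) :
    ∃ c a b e : ℕ, c + 1 ≤ d ∧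
      coeff (Finsupp.single j (a + n + 1) + Finsupp.single i (b + n + 1) + Finsupp.single u (e + w) +
        Finsupp.single f (d - 1 - c)) s.F ≠ 0 ∧ b + e + 1 ≤ c := by
  obtain ⟨m, hm, hlt⟩ := flag_reading_axis p hiso hdiv j
  have hrj : s.r j = n := by rw [hr]; simp [hji, hju]
  have hri : s.r i = n := by rw [hr]; simp [hji.symm, hiu]
  have hrdeg : s.r.degree = 2 * n + w := by
    rw [hr, map_add, map_add, Finsupp.degree_single, Finsupp.degree_single, Finsupp.degree_single]; ring
  rw [hrj, hrdeg] at hlt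
  have hmdeg := degree_eq_quad hji hju hjf hiu hif huf m
  -- the witness has `f`-degree `≤ d − 1`, hence (ledger) both slot exponents `≥ n + 1`
  have hmem : s.r + m ∈ s.F.support := MvPolynomial.mem_support_iff.mpr hm
  have hmf : m f ≤ d - 1 := by omega
  obtain ⟨hj1, hi1⟩ := hled _ hmem (by rw [Finsupp.add_apply, hr]; simp [hjf.symm, hif.symm, huf.symm]; omega)
  rw [Finsupp.add_apply, hrj] at hj1
  rw [Finsupp.add_apply, hri] at hi1
  refine ⟨d - 1 - m f, m j - 1, m i - 1, m u, by omega, ?_, by omega⟩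
  have heq : (Finsupp.single j (m j - 1 + n + 1) + Finsupp.single i (m i - 1 + n + 1) + Finsupp.single u (m u + w) +
      Finsupp.single f (d - 1 - (d - 1 - m f)) : Fin 4 →₀ ℕ) = s.r + m := by
    rw [hr]
    ext k
    rcases letters_exhaust hji hju hjf hiu hif huf k with rfl | rfl | rfl | rfl
    · simp [hji, hju, hjf]; omega
    · simp [hji.symm, hiu, hif]; omega
    · simp [hju.symm, hiu.symm, huf]; omega
    · simp [hjf.symm, hif.symm, huf.symm]; omega
  rw [heq]
  exact hm

/-- **FLAG ALONG THE AXIS OF THE OTHER SLOT `i` IN GAME COORDINATES, every prime, every σ** (`hflagM`): same hypotheses; a present game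
monomial `E(c,a,b,e)`, `c + 1 ≤ d`, with `a + e + 1 ≤ c`. [OURS] [cite: CossartJannsenSaito2020, Thm. 3.14] -/
theorem twoSlot_flagM_gameExp_sigma (p : ℕ) {n w d : ℕ} (hσ : n + w + d = p) {s : State K}
    (hr : s.r = Finsupp.single j n + Finsupp.single i n + Finsupp.single u w) (hiso : IsIsolated p s.F)
    (hdiv : ∀ e ∈ s.F.support, s.r ≤ e) (hled : ∀ e ∈ s.F.support, e f ≤ d - 1 → n + 1 ≤ e j ∧ n + 1 ≤ e i) :
    ∃ c a b e : ℕ, c + 1 ≤ d ∧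
      coeff (Finsupp.single j (a + n + 1) + Finsupp.single i (b + n + 1) + Finsupp.single u (e + w) +
        Finsupp.single f (d - 1 - c)) s.F ≠ 0 ∧ a + e + 1 ≤ c := by
  have hr' : s.r = Finsupp.single i n + Finsupp.single j n + Finsupp.single u w := by rw [hr, add_comm (Finsupp.single j n)]
  obtain ⟨c, b, a, e, hc, h, hflag⟩ := twoSlot_flagL_gameExp_sigma hji.symm hiu hif hju hjf huf p hσ hr' hiso hdiv
    (fun e he hef => (hled e he hef).symm)
  refine ⟨c, a, b, e, hc, ?_, hflag⟩
  rwa [gameExp_swap] at h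

end Game

end ResCone

end Summit.ResolutionOfSingularities.ResolutionOfSingularities.Theorems.PIDim4

end
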